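import Literature.AlgebraicGeometry.Frobenioids.BirationalizationBiratData
import Literature.AlgebraicGeometry.Frobenioids.BirationalizationIsos
import Literature.AlgebraicGeometry.Frobenioids.BiratLocalization
import Literature.AlgebraicGeometry.Frobenioids.TwoLevelFrobenioidIsFrobenioid
import HarnessLib

/-!
# Frobenioids I, Proposition 4.4 (iii) FAILS at the birationalization of a Frobenioid that is not of
# isotropic type: the two-level Frobenioid

Mochizuki, *The geometry of Frobenioids I: the general theory*, Kyushu J. Math. **62** (2008)
293–400, §4, Proposition 4.4 (iii), kurims text p. 83 [cite: MochizukiFrdI2008, Prop. 4.4 (iii) p.83]: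
"There exists a unique subfunctor of groups `Φ^birat ⊆ Φ^gp` such that the functor `C^birat → F_{Φ^gp}`
of (i) factors through the subcategory `F_{Φ^birat} ⊆ F_{Φ^gp}` determined by `Φ^birat`, and, moreover,
the resulting functor `C^birat → F_{Φ^birat}` induces, for each `A^birat ∈ Ob(C^birat)`, a surjection
`O^×(A^birat) ↠ Φ^birat(A^birat)` …" — asserted for an ARBITRARY Frobenioid (standing data of §4,
p. 75: "a divisorial monoid `Φ` on a connected, totally epimorphic category `D` and a Frobenioid
`C → F_Φ`"; the printed proof, p. 85: "assertion (iii) follows immediately from the existence of the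
functor `C^birat → F_{Φ^gp}` of assertion (i)"; unchanged by the author's Comments (2024), item (29)).

OURS (abc-iut cell; finding of seat abc-iut-w4-d020): for the TWO-LEVEL Frobenioid `C → F_Φ` of
`TwoLevelFrobenioid*.lean` (seat abc-iut-L5/L1 test object: objects `low`, `top` over `D = B(ℤ/2)`,
`Φ ≡ ℤ_{≥0}`, `End(low) = {(g, z, 1) : z ≡ ε(g) mod 2}`, `Hom(low, top) = End(top) =` all triples,
`Hom(top, low) = ∅`; `IsFrobenioid` PROVED there, `low` not isotropic) the surjectivity clause is
false at `A = low` for THE birationalization `biratData` (`BirationalizationBiratData.lean`):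
* every unit of `low^birat` is a class `[(α, φ)]` of two base-equivalent endomorphisms of `low`, whose
  divisors have the same parity `ε(Base)`, so its `Φ^gp`-divisor `Div φ − Div α ∈ ℤ` is EVEN
  (`parity_biratDivHom_low`);
* the endomorphism `(1, 1, 1)` of `top` is a co-angular pre-step, so (paired with the identity) the odd
  element `1 ∈ ℤ = Φ^gp(∗)` is a birational germ at `top`, hence lies in the canonical `Φ^birat(∗)`
  (`of_ofAdd_one_mem_biratSubgroup`), and it is the divisor of the unit `(1, 1, 1)^birat` of `top^birat`
  (`biratDivHom_topUnit`).
Consequently `¬ Prop44iii (biratData …)` (`not_prop44iii_biratData`), and more: NO subgroup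
`P ⊆ Φ^gp(∗)` receives the divisors of the units of `top^birat` while being exhausted by those of
`low^birat` (`not_exists_phiBirat`) — since `Base(low) = Base(top) = ∗`, no subfunctor `Φ^birat` of
`Φ^gp` on `D` whatsoever makes the printed (iii) true for this Frobenioid. Hence Prop. 4.4 (iii) does
not hold for all Frobenioids (`not_forall_prop44iii_biratData`); it does hold for Frobenioids of
isotropic type (`BirationalizationProp44UnitsProofs.lean`), which is the generality in which §5 uses
it (Thm. 5.1: `C` of isotropic type). PROOF-ONLY file (theorems only). Nothing here bears on the
disputed parts of [IUTchIII].
-/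

namespace Literature.AlgebraicGeometry.Frobenioids

open CategoryTheory Opposite

namespace TwoLevel

open PreFrobenioid

/-! ### The parity of an element of `Φ^gp(Y) = ℤ` -/

/-- The parity homomorphism `ℤ = Φ^gp(Y) → ℤ/2` (`Y ∈ Ob(D)`; `Φ ≡ ℤ_{≥0}`) on generators:
`z ↦ z mod 2 = par z`. [cite: MochizukiFrdI2008, Prop. 4.4 (iii) p.83] -/
theorem parity_of (Y : D) (z : Φ.obj (op Y)) :
    Algebra.GrothendieckGroup.lift (M := Φ.obj (op Y))
        (AddMonoidHom.toMultiplicative (Nat.castAddMonoidHom (ZMod 2)) : M →* Multiplicative (ZMod 2))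
        (Algebra.GrothendieckGroup.of z) = Multiplicative.ofAdd (par z) := by
  have h := Algebra.GrothendieckGroup.lift.symm_apply_apply
    (show Φ.obj (op Y) →* Multiplicative (ZMod 2) from
      (AddMonoidHom.toMultiplicative (Nat.castAddMonoidHom (ZMod 2)) : M →* Multiplicative (ZMod 2)))
  rw [Algebra.GrothendieckGroup.lift_symm_apply] at h
  exact DFunLike.congr_fun h z

/-- The parity is invariant under the pull-back maps `Φ(g)` (trivial action).
[cite: MochizukiFrdI2008, Prop. 4.4 (iii) p.83] -/
theorem parity_pullGp {A B : D} (g : A ⟶ B) (x : Algebra.GrothendieckGroup (Φ.obj (op B))) :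
    Algebra.GrothendieckGroup.lift (M := Φ.obj (op A))
        (AddMonoidHom.toMultiplicative (Nat.castAddMonoidHom (ZMod 2)) : M →* Multiplicative (ZMod 2)) (pullGp Φ g x) =
      Algebra.GrothendieckGroup.lift (M := Φ.obj (op B))
        (AddMonoidHom.toMultiplicative (Nat.castAddMonoidHom (ZMod 2)) : M →* Multiplicative (ZMod 2)) x := by
  suffices key : (Algebra.GrothendieckGroup.lift (M := Φ.obj (op A))
        (AddMonoidHom.toMultiplicative (Nat.castAddMonoidHom (ZMod 2)) : M →* Multiplicative (ZMod 2))).comp (pullGp Φ g) =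
      Algebra.GrothendieckGroup.lift (M := Φ.obj (op B))
        (AddMonoidHom.toMultiplicative (Nat.castAddMonoidHom (ZMod 2)) : M →* Multiplicative (ZMod 2)) from
    DFunLike.congr_fun key x
  apply Algebra.GrothendieckGroup.lift.symm.injective
  rw [Algebra.GrothendieckGroup.lift_symm_apply, Algebra.GrothendieckGroup.lift_symm_apply]
  refine MonoidHom.ext fun z => ?_
  change Algebra.GrothendieckGroup.lift (M := Φ.obj (op A))
        (AddMonoidHom.toMultiplicative (Nat.castAddMonoidHom (ZMod 2)) : M →* Multiplicative (ZMod 2))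
        (pullGp Φ g (Algebra.GrothendieckGroup.of z)) =
      Algebra.GrothendieckGroup.lift (M := Φ.obj (op B))
        (AddMonoidHom.toMultiplicative (Nat.castAddMonoidHom (ZMod 2)) : M →* Multiplicative (ZMod 2)) (Algebra.GrothendieckGroup.of z)
  rw [pullGp_of' g z, parity_of, parity_of]
  rfl

/-! ### Units of `low^birat` have even divisors -/

/-- Every unit of `low^birat` (for `C^birat → F_{0_D}`) has a `Φ^gp`-divisor of EVEN parity: it is a
class `[(α, φ)]` of base-equivalent endomorphisms `α = (g, z₁, 1)`, `φ = (g, z₂, 1)` of `low`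
(there is no arrow `top → low`), and `z₁ ≡ ε(g) ≡ z₂ (mod 2)`. [cite: MochizukiFrdI2008, Prop. 4.4 (iii) p.83] -/
theorem parity_biratDivHom_low (hsq : HasBiratSquares toElem)
    (u : (biratOps isFrobenioid hsq).unitsSubgroup ((toBirat toElem isFrobenioid hsq).obj Obj.low)) :
    Algebra.GrothendieckGroup.lift (M := Φ.obj (op (baseObj toElem Obj.low)))
        (AddMonoidHom.toMultiplicative (Nat.castAddMonoidHom (ZMod 2)) : M →* Multiplicative (ZMod 2))
        (biratDivHom isFrobenioid hsq Obj.low u) = 1 := by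
  obtain ⟨f, hf⟩ : ∃ f : BiratFrac toElem Obj.low Obj.low, Birat.homMk f = u.1.hom :=
    Birat.homMk_surjective u.1.hom
  obtain ⟨-, hb⟩ := isPreStep_num_of_mem_unitsSubgroup u f hf
  rw [biratDivHom_apply_of_eq u f hf]
  obtain ⟨src, den, num, den_mem⟩ := f
  cases src with
  | top => exact (no_top_low den).elim
  | low =>
    have hb' : bs den.1 = bs num.1 := hb
    have hdeg : ((degFr toElem num : ℕ+) : ℕ) = 1 := by rw [degFr_def, dg_low]; rfl
    unfold BiratFrac.divGp BiratFrac.deg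
    dsimp only
    rw [parity_pullGp, map_div, map_pow, parity_of, parity_of, hdeg, pow_one, div_eq_one]
    change Multiplicative.ofAdd (par (dv num.1)) = Multiplicative.ofAdd (par (dv den.1))
    rw [par_low, par_low, hb']

/-! ### The odd germ at `top` -/

/-- The endomorphism `(1, 1, 1)` of `top` (base `1`, divisor `1 ∈ ℤ_{≥0}`, degree `1`) is a co-angular
pre-step, base-equivalent to the identity `(1, 0, 1)`; their birational germ is the odd element
`1 ∈ ℤ = Φ^gp(∗)`, which therefore lies in the canonical `Φ^birat(∗)` (seat abc-iut-L1-t5's generated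
subfunctor). [cite: MochizukiFrdI2008, Prop. 4.4 (iii) p.83] -/
theorem of_ofAdd_one_mem_biratSubgroup :
    Algebra.GrothendieckGroup.of (M := Φ.obj (op (baseObj toElem Obj.top))) (Multiplicative.ofAdd (1 : ℕ)) ∈
      biratSubgroup toElem (baseObj toElem Obj.top) := by
  have h₁ : IsCoAngularPreStep toElem (toTop Obj.top 1 (Multiplicative.ofAdd (1 : ℕ)) 1) :=
    isCoAngularPreStep_top rfl
  have h₂ : IsPreStep toElem (toTop Obj.top 1 1 1) := (isPreStep_iff _).mpr rfl
  have hb : BaseEquivalent toElem (toTop Obj.top 1 (Multiplicative.ofAdd (1 : ℕ)) 1) (toTop Obj.top 1 1 1) :=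
    rfl
  have hmem := mem_biratSubfunctor_of_mem_biratGerms toElem
    ⟨Obj.top, toTop Obj.top 1 (Multiplicative.ofAdd (1 : ℕ)) 1, toTop Obj.top 1 1 1, h₁, h₂, hb, rfl⟩
  have heq : Algebra.GrothendieckGroup.of (invDiv toElem (toTop Obj.top 1 (Multiplicative.ofAdd (1 : ℕ)) 1) h₁.2.2) /
      Algebra.GrothendieckGroup.of (invDiv toElem (toTop Obj.top 1 1 1) h₂.2) =
        Algebra.GrothendieckGroup.of (M := Φ.obj (op (baseObj toElem Obj.top)))
          (Multiplicative.ofAdd (1 : ℕ)) := by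
    change Algebra.GrothendieckGroup.of (M := Φ.obj (op (baseObj toElem Obj.top)))
          (Multiplicative.ofAdd (1 : ℕ)) /
        Algebra.GrothendieckGroup.of (M := Φ.obj (op (baseObj toElem Obj.top))) 1 = _
    rw [MonoidHom.map_one, div_one]
  rw [heq] at hmem
  exact hmem

/-- The odd element `1 ∈ Φ^gp(∗)` IS the divisor of a unit of `top^birat`: the image of the co-angular
pre-step `(1, 1, 1) : top → top`, an isomorphism of `C^birat` (Prop. 4.4 (iv)).
[cite: MochizukiFrdI2008, Prop. 4.4 (iii) p.83] -/
theorem biratDivHom_topUnit (hsq : HasBiratSquares toElem) :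
    ∃ u : (biratOps isFrobenioid hsq).unitsSubgroup ((toBirat toElem isFrobenioid hsq).obj Obj.top),
      biratDivHom isFrobenioid hsq Obj.top u =
        Algebra.GrothendieckGroup.of (M := Φ.obj (op (baseObj toElem Obj.top)))
          (Multiplicative.ofAdd (1 : ℕ)) := by
  have h₁ : IsCoAngularPreStep toElem (toTop Obj.top 1 (Multiplicative.ofAdd (1 : ℕ)) 1) :=
    isCoAngularPreStep_top rfl
  haveI := Birat.isIso_toBirat_map (hF := isFrobenioid) (hsq := hsq) _ h₁
  refine ⟨⟨asIso ((toBirat toElem isFrobenioid hsq).map (toTop Obj.top 1 (Multiplicative.ofAdd (1 : ℕ)) 1)),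
    ?_, ?_⟩, ?_⟩
  · change (biratOps isFrobenioid hsq).base.map
      ((toBirat toElem isFrobenioid hsq).map (toTop Obj.top 1 (Multiplicative.ofAdd (1 : ℕ)) 1)) = 𝟙 _
    rw [biratOps_base_map_toBirat]
    rfl
  · change (biratOps isFrobenioid hsq).degFr
      ((toBirat toElem isFrobenioid hsq).map (toTop Obj.top 1 (Multiplicative.ofAdd (1 : ℕ)) 1)) = 1
    rw [biratOps_degFr_toBirat]
    rfl
  · rw [biratDivHom_apply_of_eq _ (BiratFrac.ofHom isFrobenioid
      (toTop Obj.top 1 (Multiplicative.ofAdd (1 : ℕ)) 1)) rfl, BiratFrac.divGp_ofHom]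
    rfl

/-! ### Prop. 4.4 (iii) fails for the two-level Frobenioid -/

/-- **No candidate `Φ^birat(∗)` works**: there is no subgroup `P ⊆ Φ^gp(∗)` containing the divisors
of the units of `top^birat` and exhausted by the divisors of the units of `low^birat` (both objects
lie over the unique base object `∗ = Base(low) = Base(top)`). [cite: MochizukiFrdI2008, Prop. 4.4 (iii) p.83] -/
theorem not_exists_phiBirat (hsq : HasBiratSquares toElem) :
    ¬ ∃ P : Subgroup (Algebra.GrothendieckGroup (Φ.obj (op (baseObj toElem Obj.low)))),
      (∀ u : (biratOps isFrobenioid hsq).unitsSubgroup ((toBirat toElem isFrobenioid hsq).obj Obj.top),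
          biratDivHom isFrobenioid hsq Obj.top u ∈ P) ∧
      ∀ y ∈ P, ∃ u : (biratOps isFrobenioid hsq).unitsSubgroup
          ((toBirat toElem isFrobenioid hsq).obj Obj.low), biratDivHom isFrobenioid hsq Obj.low u = y := by
  rintro ⟨P, htop, hlow⟩
  obtain ⟨u₀, hu₀⟩ := biratDivHom_topUnit hsq
  have h₀ : Algebra.GrothendieckGroup.of (M := Φ.obj (op (baseObj toElem Obj.low)))
      (Multiplicative.ofAdd (1 : ℕ)) ∈ P := hu₀ ▸ htop u₀
  obtain ⟨u, hu⟩ := hlow _ h₀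
  have h := parity_biratDivHom_low hsq u
  rw [hu, parity_of] at h
  exact absurd (congrArg Multiplicative.toAdd h) (by decide)

/-- **[FrdI] Prop. 4.4 (iii) AS TYPED (`PreFrobenioidData.Prop44iii`, seat abc-iut-L1-t3) is FALSE
at THE birationalization `biratData` of the two-level Frobenioid** (for any admissible family of
composition squares `hsq`): the odd germ `1 ∈ Φ^birat(∗)` is not the divisor of a unit of
`low^birat`. [cite: MochizukiFrdI2008, Prop. 4.4 (iii) p.83] -/
theorem not_prop44iii_biratData (hsq : HasBiratSquares toElem) :
    ¬ PreFrobenioidData.Prop44iii (biratData isFrobenioid hsq) := by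
  intro h
  obtain ⟨u, hu⟩ := (h Obj.low).1 _ of_ofAdd_one_mem_biratSubgroup
  have hu' : biratDivHom isFrobenioid hsq Obj.low u =
      Algebra.GrothendieckGroup.of (M := Φ.obj (op (baseObj toElem Obj.low)))
        (Multiplicative.ofAdd (1 : ℕ)) := hu
  have h1 := parity_biratDivHom_low hsq u
  rw [hu', parity_of] at h1
  exact absurd (congrArg Multiplicative.toAdd h1) (by decide)

/-- The same for the canonical composition squares of a Frobenioid
(`hasBiratSquares_of_isFrobenioid`). [cite: MochizukiFrdI2008, Prop. 4.4 (iii) p.83] -/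
theorem not_prop44iii_biratData_canonical :
    ¬ PreFrobenioidData.Prop44iii
      (biratData isFrobenioid (hasBiratSquares_of_isFrobenioid isFrobenioid)) :=
  not_prop44iii_biratData _

/-- **[FrdI] Prop. 4.4 (iii) does not hold for every Frobenioid**: the typed statement at THE
birationalization is refuted by the two-level Frobenioid (which is not of isotropic type; for
isotropic type it holds, `BirationalizationProp44UnitsProofs.lean`).
[cite: MochizukiFrdI2008, Prop. 4.4 (iii) p.83] -/
theorem not_forall_prop44iii_biratData :
    ¬ ∀ {D : Type} [Category.{0} D] {Φ : Dᵒᵖ ⥤ CommMonCat.{0}} {C : Type} [Category.{0} C]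
        (F : C ⥤ ElemFrobenioid Φ) (hF : IsFrobenioid F),
        PreFrobenioidData.Prop44iii (biratData hF (hasBiratSquares_of_isFrobenioid hF)) :=
  fun h => not_prop44iii_biratData_canonical (h toElem isFrobenioid)

end TwoLevel

end Literature.AlgebraicGeometry.Frobenioids
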